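import Mathlib
import Summits.ValiantsHypothesis.ValiantsHypothesis.Theorems.NewtonUnitEquationsDissociatedUniformTotalsLaw
import Summits.ValiantsHypothesis.ValiantsHypothesis.Theorems.NewtonUnitEquationsDissociatedUniformTotalsLawHexagon
import HarnessLib

/-!
# Crux `NewtonUnitEquations.DissociatedUniform` (stmt-ValiantsHypothesis-5905), `n = 3` totals law of model (Q**):
# counting fold vertices — `T ≤ 2·(N_a + N_b + N_c)` sign changes of the orientation tensor

Continuation of `…TotalsLawHexagon` (hexagon criterion: a vertex of `conv(class s)` at the label triple `(x, y, z)` has a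
hexagon of orientations `orientT a b c i j k = orient(Δa i, Δb j, Δc k)` that is NOT constant-sign).  Here the bookkeeping that
turns the criterion into a bound for the totals `T = totalVert a b c` over `ℤ/q`, valid for ALL curves `a, b, c`:

* `HexMixed a b c x y z := ¬ HexPos ∧ ¬ HexNeg`; `classVert_le_sum_hexMixed`: `V_s ≤ #{(x, y) : HexMixed (x, y, s-x-y)}`;
* `totalVert_le_sum_hexMixed`: `T ≤ #{(x, y, z) ∈ (ℤ/q)³ : HexMixed (x, y, z)}` (the classes partition the triples);
* a mixed hexagon has an edge whose two orientations have product `≤ 0`; the six hexagon edges are edges of the tensor in the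
  three lattice directions (`flipA i j k : O(i,j,k)·O(i+1,j,k) ≤ 0`, `flipB`, `flipC`), each tensor edge serving two triples, so
  **`totalVert_le_two_mul_flips`**: `T ≤ 2·(N_a + N_b + N_c)` with `N_a = flipsA a b c = #{(i,j,k) : flipA i j k}` etc.

For general curves `N_a + N_b + N_c` can be cubic in `q` (census: random point sets `≈ 12 q²` mixed hexagons at `q = 13` and
growing); the point of the reduction is the next file `…TotalsLawHodograph`: when the hodograph `Δc` is convexly ordered, every
line meets it in a sign pattern with at most two changes, so `N_c ≤ 2q² + 2·#{zeros}`, and symmetrically — the HODOGRAPH-CONVEX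
TOTALS LAW `T ≤ 12 q²` (general position).  `TotalsLawThree C` remains OPEN; VP ≠ VNP is not touched.
[folklore: double counting over a partition; a cyclic sequence of nonzero reals that is not constant-sign has two cyclically
adjacent terms of opposite sign]
-/

set_option linter.dupNamespace false -- `ValiantsHypothesis.ValiantsHypothesis` (summit = problem) in every name

open scoped BigOperators Pointwise

namespace Summit.ValiantsHypothesis.ValiantsHypothesis.Theorems.NewtonUnitEquationsDissociatedUniform

namespace TotalsLaw

/-! ### Indicators -/

open Classical in
/-- The `{0,1}`-indicator of a proposition (classical). [folklore] -/
noncomputable def indic (P : Prop) : ℕ := if P then 1 else 0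

/-- `indic P ≤ 1`. [folklore] -/
theorem indic_le_one (P : Prop) : indic P ≤ 1 := by
  unfold indic; split_ifs <;> simp

/-- `indic` of a true proposition. [folklore] -/
theorem indic_of_true {P : Prop} (h : P) : indic P = 1 := by
  unfold indic; rw [if_pos h]

/-- `indic` of a false proposition. [folklore] -/
theorem indic_of_false {P : Prop} (h : ¬ P) : indic P = 0 := by
  unfold indic; rw [if_neg h]

/-- Monotonicity of the indicator. [folklore] -/
theorem indic_mono {P Q : Prop} (h : P → Q) : indic P ≤ indic Q := by
  by_cases hp : P
  · rw [indic_of_true hp, indic_of_true (h hp)]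
  · rw [indic_of_false hp]; exact Nat.zero_le _

/-- Subadditivity over a six-fold disjunction. [folklore] -/
theorem indic_or_six_le {P₁ P₂ P₃ P₄ P₅ P₆ : Prop} :
    indic (P₁ ∨ P₂ ∨ P₃ ∨ P₄ ∨ P₅ ∨ P₆) ≤ indic P₁ + indic P₂ + indic P₃ + indic P₄ + indic P₅ + indic P₆ := by
  by_cases h : P₁ ∨ P₂ ∨ P₃ ∨ P₄ ∨ P₅ ∨ P₆
  · rw [indic_of_true h]
    rcases h with h | h | h | h | h | h <;> (rw [indic_of_true h]; omega)
  · rw [indic_of_false h]; exact Nat.zero_le _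

/-! ### Mixed hexagons and the class count -/

section Count

variable {q : ℕ} [NeZero q]

/-- The hexagon of `(x, y, z)` is MIXED: neither all six orientations positive nor all six negative. -/
def HexMixed (a b c : ZMod q → (Fin 2 → ℝ)) (x y z : ZMod q) : Prop := ¬ HexPos a b c x y z ∧ ¬ HexNeg a b c x y z

variable (a b c : ZMod q → (Fin 2 → ℝ))

/-- **`V_s ≤ #`mixed hexagons of class `s`.**  Every vertex of `conv(class s)` is `a x + b y + c (s - x - y)` for a label pair
`(x, y)` whose hexagon is mixed (`not_hexPos_and_not_hexNeg_of_mem_extremePoints`), and distinct vertices have distinct label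
pairs. [folklore] -/
theorem classVert_le_sum_hexMixed (s : ZMod q) :
    classVert a b c s ≤ ∑ x : ZMod q, ∑ y : ZMod q, indic (HexMixed a b c x y (s - x - y)) := by
  classical
  unfold classVert
  set E := (convexHull ℝ (classPts a b c s)).extremePoints ℝ with hE
  set φ : ZMod q × ZMod q → (Fin 2 → ℝ) := fun xy => a xy.1 + b xy.2 + c (s - xy.1 - xy.2) with hφ
  set M : Finset (ZMod q × ZMod q) := Finset.univ.filter fun xy => HexMixed a b c xy.1 xy.2 (s - xy.1 - xy.2) with hM
  have hsub : E ⊆ φ '' (M : Set (ZMod q × ZMod q)) := by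
    intro p hp
    have hp' : p ∈ classPts a b c s := extremePoints_convexHull_subset hp
    obtain ⟨xy, rfl⟩ := hp'
    refine ⟨xy, ?_, rfl⟩
    rw [Finset.mem_coe, hM, Finset.mem_filter]
    exact ⟨Finset.mem_univ _, not_hexPos_and_not_hexNeg_of_mem_extremePoints hp⟩
  have hfin : (φ '' (M : Set (ZMod q × ZMod q))).Finite := M.finite_toSet.image φ
  calc E.ncard ≤ (φ '' (M : Set (ZMod q × ZMod q))).ncard := Set.ncard_le_ncard hsub hfin
    _ ≤ (M : Set (ZMod q × ZMod q)).ncard := Set.ncard_image_le M.finite_toSet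
    _ = M.card := Set.ncard_coe_finset M
    _ = ∑ xy : ZMod q × ZMod q, indic (HexMixed a b c xy.1 xy.2 (s - xy.1 - xy.2)) := by
        rw [hM, Finset.card_filter]
        rfl
    _ = ∑ x : ZMod q, ∑ y : ZMod q, indic (HexMixed a b c x y (s - x - y)) := Fintype.sum_prod_type _

/-- Reindexing a class sum by the third label: `∑_s f (s - x - y) = ∑_z f z`. [folklore] -/
theorem sum_sub_sub_eq (f : ZMod q → ℕ) (x y : ZMod q) : ∑ s : ZMod q, f (s - x - y) = ∑ z : ZMod q, f z := by
  have h := Equiv.sum_comp (Equiv.subRight (x + y)) f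
  simpa [Equiv.subRight_apply, sub_sub] using h

/-- **`T ≤ #`mixed hexagons.**  Summing `classVert_le_sum_hexMixed` over the classes and reindexing `(s, x, y) ↔ (x, y, z)`:
`T ≤ #{(x, y, z) ∈ (ℤ/q)³ : HexMixed (x, y, z)}`. [folklore] -/
theorem totalVert_le_sum_hexMixed :
    totalVert a b c ≤ ∑ x : ZMod q, ∑ y : ZMod q, ∑ z : ZMod q, indic (HexMixed a b c x y z) := by
  unfold totalVert
  calc ∑ s, classVert a b c s ≤ ∑ s : ZMod q, ∑ x : ZMod q, ∑ y : ZMod q, indic (HexMixed a b c x y (s - x - y)) :=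
        Finset.sum_le_sum fun s _ => classVert_le_sum_hexMixed a b c s
    _ = ∑ x : ZMod q, ∑ s : ZMod q, ∑ y : ZMod q, indic (HexMixed a b c x y (s - x - y)) := Finset.sum_comm
    _ = ∑ x : ZMod q, ∑ y : ZMod q, ∑ s : ZMod q, indic (HexMixed a b c x y (s - x - y)) :=
        Finset.sum_congr rfl fun x _ => Finset.sum_comm
    _ = ∑ x : ZMod q, ∑ y : ZMod q, ∑ z : ZMod q, indic (HexMixed a b c x y z) :=
        Finset.sum_congr rfl fun x _ => Finset.sum_congr rfl fun y _ =>
          sum_sub_sub_eq (fun z => indic (HexMixed a b c x y z)) x y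

/-! ### Sign changes of the orientation tensor along the three lattice directions -/

/-- A SIGN CHANGE of the tensor in the `a`-direction at `(i, j, k)`: `O(i,j,k) · O(i+1,j,k) ≤ 0`. -/
def flipA (i j k : ZMod q) : Prop := orientT a b c i j k * orientT a b c (i + 1) j k ≤ 0

/-- A sign change in the `b`-direction at `(i, j, k)`: `O(i,j,k) · O(i,j+1,k) ≤ 0`. -/
def flipB (i j k : ZMod q) : Prop := orientT a b c i j k * orientT a b c i (j + 1) k ≤ 0

/-- A sign change in the `c`-direction at `(i, j, k)`: `O(i,j,k) · O(i,j,k+1) ≤ 0`. -/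
def flipC (i j k : ZMod q) : Prop := orientT a b c i j k * orientT a b c i j (k + 1) ≤ 0

/-- `N_a`: the number of `a`-direction sign changes of the tensor. -/
noncomputable def flipsA : ℕ := ∑ i : ZMod q, ∑ j : ZMod q, ∑ k : ZMod q, indic (flipA a b c i j k)

/-- `N_b`: the number of `b`-direction sign changes. -/
noncomputable def flipsB : ℕ := ∑ i : ZMod q, ∑ j : ZMod q, ∑ k : ZMod q, indic (flipB a b c i j k)

/-- `N_c`: the number of `c`-direction sign changes. -/
noncomputable def flipsC : ℕ := ∑ i : ZMod q, ∑ j : ZMod q, ∑ k : ZMod q, indic (flipC a b c i j k)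

omit [NeZero q] in
/-- Six nonzero-product-chained reals are all positive or all negative: if the six cyclic products `o₂o₁, o₂o₃, o₄o₃, o₄o₅,
o₆o₅, o₆o₁` are positive then the `oᵢ` have a common strict sign. [folklore] -/
theorem hex_edge_of_mixed {o₁ o₂ o₃ o₄ o₅ o₆ : ℝ}
    (hpos : ¬ (0 < o₁ ∧ 0 < o₂ ∧ 0 < o₃ ∧ 0 < o₄ ∧ 0 < o₅ ∧ 0 < o₆))
    (hneg : ¬ (o₁ < 0 ∧ o₂ < 0 ∧ o₃ < 0 ∧ o₄ < 0 ∧ o₅ < 0 ∧ o₆ < 0)) :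
    o₂ * o₁ ≤ 0 ∨ o₂ * o₃ ≤ 0 ∨ o₄ * o₃ ≤ 0 ∨ o₄ * o₅ ≤ 0 ∨ o₆ * o₅ ≤ 0 ∨ o₆ * o₁ ≤ 0 := by
  by_contra hcon
  push Not at hcon
  obtain ⟨e₁, e₂, e₃, e₄, e₅, e₆⟩ := hcon
  rcases lt_trichotomy o₁ 0 with h₁ | h₁ | h₁
  · have h₂ : o₂ < 0 := by nlinarith
    have h₃ : o₃ < 0 := by nlinarith
    have h₄ : o₄ < 0 := by nlinarith
    have h₅ : o₅ < 0 := by nlinarith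
    have h₆ : o₆ < 0 := by nlinarith
    exact hneg ⟨h₁, h₂, h₃, h₄, h₅, h₆⟩
  · rw [h₁, mul_zero] at e₁; exact lt_irrefl _ e₁
  · have h₂ : 0 < o₂ := by nlinarith
    have h₃ : 0 < o₃ := by nlinarith
    have h₄ : 0 < o₄ := by nlinarith
    have h₅ : 0 < o₅ := by nlinarith
    have h₆ : 0 < o₆ := by nlinarith
    exact hpos ⟨h₁, h₂, h₃, h₄, h₅, h₆⟩

omit [NeZero q] in
/-- **A mixed hexagon contains a tensor sign change.**  The six edges of the hexagon of `(x, y, z)` are the tensor edges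
`flipA (x-1, y, z-1)`, `flipC (x-1, y, z-1)`, `flipB (x-1, y-1, z)`, `flipA (x-1, y-1, z)`, `flipC (x, y-1, z-1)`,
`flipB (x, y-1, z-1)`. [folklore] -/
theorem flip_of_hexMixed {x y z : ZMod q} (h : HexMixed a b c x y z) :
    flipA a b c (x - 1) y (z - 1) ∨ flipC a b c (x - 1) y (z - 1) ∨ flipB a b c (x - 1) (y - 1) z ∨
      flipA a b c (x - 1) (y - 1) z ∨ flipC a b c x (y - 1) (z - 1) ∨ flipB a b c x (y - 1) (z - 1) := by
  obtain ⟨hp, hn⟩ := h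
  unfold HexPos at hp
  unfold HexNeg at hn
  have key := hex_edge_of_mixed hp hn
  simp only [flipA, flipB, flipC, sub_add_cancel]
  exact key

omit [NeZero q] in
/-- Indicator form of `flip_of_hexMixed`. [folklore] -/
theorem indic_hexMixed_le (x y z : ZMod q) :
    indic (HexMixed a b c x y z) ≤
      indic (flipA a b c (x - 1) y (z - 1)) + indic (flipC a b c (x - 1) y (z - 1)) + indic (flipB a b c (x - 1) (y - 1) z) +
        indic (flipA a b c (x - 1) (y - 1) z) + indic (flipC a b c x (y - 1) (z - 1)) + indic (flipB a b c x (y - 1) (z - 1)) :=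
  (indic_mono (flip_of_hexMixed a b c)).trans indic_or_six_le

/-- Shift reindexing in the first variable. [folklore] -/
theorem sum₃_shift₁ (f : ZMod q → ZMod q → ZMod q → ℕ) (t : ZMod q) :
    ∑ x : ZMod q, ∑ y : ZMod q, ∑ z : ZMod q, f (x - t) y z = ∑ x : ZMod q, ∑ y : ZMod q, ∑ z : ZMod q, f x y z :=
  Equiv.sum_comp (Equiv.subRight t) fun x => ∑ y : ZMod q, ∑ z : ZMod q, f x y z

/-- Shift reindexing in the second variable. [folklore] -/
theorem sum₃_shift₂ (f : ZMod q → ZMod q → ZMod q → ℕ) (t : ZMod q) :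
    ∑ x : ZMod q, ∑ y : ZMod q, ∑ z : ZMod q, f x (y - t) z = ∑ x : ZMod q, ∑ y : ZMod q, ∑ z : ZMod q, f x y z :=
  Finset.sum_congr rfl fun x _ => Equiv.sum_comp (Equiv.subRight t) fun y => ∑ z : ZMod q, f x y z

/-- Shift reindexing in the third variable. [folklore] -/
theorem sum₃_shift₃ (f : ZMod q → ZMod q → ZMod q → ℕ) (t : ZMod q) :
    ∑ x : ZMod q, ∑ y : ZMod q, ∑ z : ZMod q, f x y (z - t) = ∑ x : ZMod q, ∑ y : ZMod q, ∑ z : ZMod q, f x y z :=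
  Finset.sum_congr rfl fun x _ => Finset.sum_congr rfl fun y _ => Equiv.sum_comp (Equiv.subRight t) fun z => f x y z

/-- **`T ≤ 2 (N_a + N_b + N_c)`.**  Every class-hull vertex has a mixed hexagon (`totalVert_le_sum_hexMixed`), a mixed hexagon
contains a tensor sign change (`flip_of_hexMixed`), and each tensor edge is a hexagon edge of exactly two triples (the two index
shifts), whence the factor `2`.  Valid for ALL curves `a, b, c : ℤ/q → ℝ²`. [folklore] -/
theorem totalVert_le_two_mul_flips :
    totalVert a b c ≤ 2 * (flipsA a b c + flipsB a b c + flipsC a b c) := by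
  have h1 := totalVert_le_sum_hexMixed a b c
  have h2 : ∑ x : ZMod q, ∑ y : ZMod q, ∑ z : ZMod q, indic (HexMixed a b c x y z) ≤
      ∑ x : ZMod q, ∑ y : ZMod q, ∑ z : ZMod q,
        (indic (flipA a b c (x - 1) y (z - 1)) + indic (flipC a b c (x - 1) y (z - 1)) + indic (flipB a b c (x - 1) (y - 1) z) +
          indic (flipA a b c (x - 1) (y - 1) z) + indic (flipC a b c x (y - 1) (z - 1)) + indic (flipB a b c x (y - 1) (z - 1))) :=
    Finset.sum_le_sum fun x _ => Finset.sum_le_sum fun y _ => Finset.sum_le_sum fun z _ => indic_hexMixed_le a b c x y z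
  -- split the six sums and shift each back to the unshifted tensor count
  have eA1 : ∑ x : ZMod q, ∑ y : ZMod q, ∑ z : ZMod q, indic (flipA a b c (x - 1) y (z - 1)) = flipsA a b c := by
    unfold flipsA
    rw [sum₃_shift₁ (fun x y z => indic (flipA a b c x y (z - 1))) 1, sum₃_shift₃ (fun x y z => indic (flipA a b c x y z)) 1]
  have eC1 : ∑ x : ZMod q, ∑ y : ZMod q, ∑ z : ZMod q, indic (flipC a b c (x - 1) y (z - 1)) = flipsC a b c := by
    unfold flipsC
    rw [sum₃_shift₁ (fun x y z => indic (flipC a b c x y (z - 1))) 1, sum₃_shift₃ (fun x y z => indic (flipC a b c x y z)) 1]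
  have eB1 : ∑ x : ZMod q, ∑ y : ZMod q, ∑ z : ZMod q, indic (flipB a b c (x - 1) (y - 1) z) = flipsB a b c := by
    unfold flipsB
    rw [sum₃_shift₁ (fun x y z => indic (flipB a b c x (y - 1) z)) 1, sum₃_shift₂ (fun x y z => indic (flipB a b c x y z)) 1]
  have eA2 : ∑ x : ZMod q, ∑ y : ZMod q, ∑ z : ZMod q, indic (flipA a b c (x - 1) (y - 1) z) = flipsA a b c := by
    unfold flipsA
    rw [sum₃_shift₁ (fun x y z => indic (flipA a b c x (y - 1) z)) 1, sum₃_shift₂ (fun x y z => indic (flipA a b c x y z)) 1]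
  have eC2 : ∑ x : ZMod q, ∑ y : ZMod q, ∑ z : ZMod q, indic (flipC a b c x (y - 1) (z - 1)) = flipsC a b c := by
    unfold flipsC
    rw [sum₃_shift₂ (fun x y z => indic (flipC a b c x y (z - 1))) 1, sum₃_shift₃ (fun x y z => indic (flipC a b c x y z)) 1]
  have eB2 : ∑ x : ZMod q, ∑ y : ZMod q, ∑ z : ZMod q, indic (flipB a b c x (y - 1) (z - 1)) = flipsB a b c := by
    unfold flipsB
    rw [sum₃_shift₂ (fun x y z => indic (flipB a b c x y (z - 1))) 1, sum₃_shift₃ (fun x y z => indic (flipB a b c x y z)) 1]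
  have hsplit : ∑ x : ZMod q, ∑ y : ZMod q, ∑ z : ZMod q,
        (indic (flipA a b c (x - 1) y (z - 1)) + indic (flipC a b c (x - 1) y (z - 1)) + indic (flipB a b c (x - 1) (y - 1) z) +
          indic (flipA a b c (x - 1) (y - 1) z) + indic (flipC a b c x (y - 1) (z - 1)) + indic (flipB a b c x (y - 1) (z - 1))) =
      2 * (flipsA a b c + flipsB a b c + flipsC a b c) := by
    simp only [Finset.sum_add_distrib]
    rw [eA1, eC1, eB1, eA2, eC2, eB2]
    ring
  calc totalVert a b c ≤ _ := h1
    _ ≤ _ := h2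
    _ = _ := hsplit

end Count

end TotalsLaw

end Summit.ValiantsHypothesis.ValiantsHypothesis.Theorems.NewtonUnitEquationsDissociatedUniform
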